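import Summits.NavierStokesRegularity.NavierStokesRegularity.Theorems.FilamentSkeletonRssCoreLinearInvertibilityVolterraToolsA
import Summits.NavierStokesRegularity.NavierStokesRegularity.Theorems.FilamentSkeletonRssCoreLinearInvertibilityVolterraToolsB

/-!
# The one-variable Volterra–Hardy bound `volterraProfileBound` — crux `CoreLinearInvertibility` (stmt-NavierStokesRegularity-17973), strategist line `Lines/even_volterra.lean`.
In the even sector of the linearisation at the asymmetric Burgers–Gaussian vortex the circular mean `W` of an even
mass-zero vorticity satisfies, in the radial variable, the divergence-form flux ODE `J = r W' + (r²/2) W + μ r² A`,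
`J' = r F` (`F` = circular mean of `T_{λ,α} w`, `A` = the `cos 2θ` coefficient of the fluctuation, `μ = λ/4`,
weight `e^{βr²/4} r dr`, `β = 1 − λ ∈ (0,1]`).  The line bounds `W` by the outward Volterra reconstruction
`P := W − W(0)e^{-r²/4}`, `P' + (r/2)P = q`, `r q = J − μ r² A`, whose weighted energy identity carries the factor `r`
in the coercive term ("Volterra gain": the strain source `μ r A` is then paired with NO weight on `A`).

`volterraProfileBound`: for `0 < β ≤ 1`, `b ≥ 4`, `W ∈ C¹` with `W(b) = W'(b) = 0`, `A, F` continuous, `A(b) = 0`,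
`J = rW' + r²W/2 + μ r²A` with `J' = rF` on `[0,b]` and `∫₀ᵇ W r = 0`:
`∫₀ᵇ e^{βr²/4} W² r ≤ (10⁴/β³)(∫₀ᵇ e^{βr²/4} F² r + μ² ∫₀ᵇ e^{βr²/4} A² r)`.
Proof: pinning (`radial_mass_pinning`) + energy (`ode_weighted_energy_le`) + the pairing bound — flux part by the landed
`radial_hardy_flux` / `radial_flux_sq_le` on `[1,b]` and the centre sup bound `volterra_center_abs_le` on `[0,1]`, strain part
by weighted Cauchy–Schwarz with no weight — + `s2b_algebra`.  Identical to the theorem of the same name in the registered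
skeleton `Cruxes/CoreLinearInvertibility/Lines/even_volterra.lean` (namespace `…Cruxes.CoreLinearInvertibility.EvenVolterra`).
-/

set_option linter.dupNamespace false

noncomputable section

namespace Summit.NavierStokesRegularity.NavierStokesRegularity.Theorems

open MeasureTheory Filter Topology Set intervalIntegral

set_option maxHeartbeats 3200000 in
/-- **S2b proved**: the one-variable Volterra–Hardy bound (energy form), with `K = 10⁴`. [folklore] -/
theorem volterraProfileBound :
    ∃ K : ℝ, 0 ≤ K ∧ ∀ β : ℝ, 0 < β → β ≤ 1 → ∀ (μ b : ℝ), 4 ≤ b →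
    ∀ (W W₁ A F J : ℝ → ℝ), (∀ r, HasDerivAt W (W₁ r) r) → Continuous W₁ → Continuous A → Continuous F →
    (∀ r, J r = r * W₁ r + r ^ 2 / 2 * W r + μ * (r ^ 2 * A r)) →
    (∀ r ∈ Set.Icc 0 b, HasDerivAt J (r * F r) r) → W b = 0 → W₁ b = 0 → A b = 0 →
    (∫ r in (0:ℝ)..b, W r * r = 0) →
    ∫ r in (0:ℝ)..b, Real.exp (β / 4 * r ^ 2) * W r ^ 2 * r ≤
      K / β ^ 3 * ((∫ r in (0:ℝ)..b, Real.exp (β / 4 * r ^ 2) * F r ^ 2 * r) +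
        μ ^ 2 * ∫ r in (0:ℝ)..b, Real.exp (β / 4 * r ^ 2) * A r ^ 2 * r) := by
  refine ⟨10 ^ 4, by norm_num, ?_⟩
  intro β hβ hβ1 μ b hb W W₁ A F J hWd hW₁c hAc hFc hJ hJ' hWb hW₁b hAb hmass
  have hb0 : (0:ℝ) ≤ b := by linarith
  have hb1 : (1:ℝ) ≤ b := by linarith
  have hWc : Continuous W := continuous_iff_continuousAt.2 fun s => (hWd s).continuousAt
  have hEc : ∀ c : ℝ, Continuous fun r : ℝ => Real.exp (c * r ^ 2) := fun c =>
    Real.continuous_exp.comp (continuous_const.mul (continuous_id.pow 2))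
  -- names for the norms
  set NW := ∫ r in (0:ℝ)..b, Real.exp (β / 4 * r ^ 2) * W r ^ 2 * r with hNW
  set NF := ∫ r in (0:ℝ)..b, Real.exp (β / 4 * r ^ 2) * F r ^ 2 * r with hNF
  set NA := ∫ r in (0:ℝ)..b, Real.exp (β / 4 * r ^ 2) * A r ^ 2 * r with hNA
  have hnn : ∀ (G : ℝ → ℝ), 0 ≤ ∫ r in (0:ℝ)..b, Real.exp (β / 4 * r ^ 2) * G r ^ 2 * r := fun G =>
    intervalIntegral.integral_nonneg hb0 fun r hr => by have := hr.1; positivity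
  have hNF0 : 0 ≤ NF := hnn F
  have hNA0 : 0 ≤ NA := hnn A
  -- the flux: `J 0 = 0`, `J b = 0`, continuity, Hardy and the pointwise bound
  have hJ0 : J 0 = 0 := by rw [hJ 0]; ring
  have hJb : J b = 0 := by rw [hJ b, hWb, hW₁b, hAb]; ring
  have hJc : Continuous J := by
    have : J = fun r => r * W₁ r + r ^ 2 / 2 * W r + μ * (r ^ 2 * A r) := funext hJ
    rw [this]; fun_prop
  have hHardy := radial_hardy_flux hβ hb0 hJc hFc hJ' hJ0 hJb
  have hJsq : ∀ r ∈ Icc 0 b, J r ^ 2 ≤ r ^ 2 / 2 * NF := fun r hr => radial_flux_sq_le hβ.le hFc hJ' hJ0 hr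
  -- the homogeneous mode and the reconstruction `P`
  set W₀ := W 0 with hW₀
  set P : ℝ → ℝ := fun r => W r - W₀ * Real.exp (-(r ^ 2 / 4)) with hPdef
  set P₁ : ℝ → ℝ := fun r => W₁ r + W₀ * (r / 2 * Real.exp (-(r ^ 2 / 4))) with hP₁def
  set q : ℝ → ℝ := fun r => W₁ r + r / 2 * W r with hqdef
  have hge : ∀ r, HasDerivAt (fun s => Real.exp (-(s ^ 2 / 4))) (-(r / 2) * Real.exp (-(r ^ 2 / 4))) r := by
    intro r
    have h := hasDerivAt_exp_mul_sq (-(1 / 4)) r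
    have e : (fun s => Real.exp (-(1 / 4) * s ^ 2)) = fun s => Real.exp (-(s ^ 2 / 4)) := by
      funext s; congr 1; ring
    rw [e] at h
    refine h.congr_deriv ?_
    have : Real.exp (-(1 / 4) * r ^ 2) = Real.exp (-(r ^ 2 / 4)) := by congr 1; ring
    rw [this]; ring
  have hP : ∀ r, HasDerivAt P (P₁ r) r := by
    intro r
    have h := (hWd r).sub ((hge r).const_mul W₀)
    refine h.congr_deriv ?_
    simp only [hP₁def]; ring
  have hP₁c : Continuous P₁ := by simp only [hP₁def]; fun_prop
  have hPc : Continuous P := by simp only [hPdef]; fun_prop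
  have hqc : Continuous q := by simp only [hqdef]; fun_prop
  have hq : ∀ s, P₁ s + s / 2 * P s = q s := by intro s; simp only [hPdef, hP₁def, hqdef]; ring
  have hP0 : P 0 = 0 := by simp [hPdef, hW₀]
  have hWP : ∀ r, W r = W₀ * Real.exp (-(r ^ 2 / 4)) + P r := by intro r; simp only [hPdef]; ring
  set NP := ∫ r in (0:ℝ)..b, Real.exp (β / 4 * r ^ 2) * P r ^ 2 * r with hNP
  have hNP0 : 0 ≤ NP := hnn P
  -- (1) pinning: `NW ≤ (10/β) NP`
  have hpin : NW ≤ 10 / β * NP := radial_mass_pinning hβ hβ1 hb hPc hWP hmass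
  -- (2) energy: `(2-β)/4 NP ≤ ∫ e P q`
  have henergy : (2 - β) / 4 * NP ≤ ∫ r in (0:ℝ)..b, Real.exp (β / 4 * r ^ 2) * P r * q r := by
    have h := ode_weighted_energy_le (β := β) (b := b) hP hP₁c hP0
    have e : ∫ r in (0:ℝ)..b, Real.exp (β / 4 * r ^ 2) * P r * (P₁ r + r / 2 * P r) =
        ∫ r in (0:ℝ)..b, Real.exp (β / 4 * r ^ 2) * P r * q r := by
      refine intervalIntegral.integral_congr fun r _ => ?_
      simp only [hq r]
    rw [e] at h
    exact h
  -- (3) the source pairing: `r q = J - μ r² A`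
  have hrq : ∀ r, r * q r = J r - μ * (r ^ 2 * A r) := by intro r; simp only [hqdef]; rw [hJ r]; ring
  -- pointwise bound `|q r + μ r A r| ≤ √(NF/2)` on `(0,b]`
  set m : ℝ := Real.sqrt (NF / 2) with hm
  have hm0 : 0 ≤ m := Real.sqrt_nonneg _
  have hmsq : m ^ 2 = NF / 2 := Real.sq_sqrt (by positivity)
  have hqA : ∀ r ∈ Ioc 0 b, |q r + μ * (r * A r)| ≤ m := by
    intro r hr
    have hr0 : 0 < r := hr.1
    have h1 : (r * (q r + μ * (r * A r))) ^ 2 ≤ r ^ 2 / 2 * NF := by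
      have : r * (q r + μ * (r * A r)) = J r := by rw [mul_add, hrq r]; ring
      rw [this]; exact hJsq r ⟨hr0.le, hr.2⟩
    have h2 : (q r + μ * (r * A r)) ^ 2 ≤ m ^ 2 := by
      rw [hmsq]
      have hr2 : 0 < r ^ 2 := by positivity
      rw [mul_pow] at h1
      exact le_of_mul_le_mul_left (by linarith : r ^ 2 * (q r + μ * (r * A r)) ^ 2 ≤ r ^ 2 * (NF / 2)) hr2
    exact abs_le_of_sq_le_sq' h2 hm0 |> fun h => abs_le.2 h
  -- the source `g := q + μ r A` (continuous, `|g| ≤ m` on `(0,b]`, `r g = J`)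
  set g : ℝ → ℝ := fun r => q r + μ * (r * A r) with hgdef
  have hgc : Continuous g := by simp only [hgdef]; fun_prop
  have hgb : ∀ r ∈ Ioc 0 b, |g r| ≤ m := hqA
  have hrg : ∀ r, r * g r = J r := by intro r; simp only [hgdef]; rw [mul_add, hrq r]; ring
  -- split `∫ e P q = I1 - μ I2`
  set I1 := ∫ r in (0:ℝ)..b, Real.exp (β / 4 * r ^ 2) * P r * g r with hI1
  set I2 := ∫ r in (0:ℝ)..b, Real.exp (β / 4 * r ^ 2) * r * P r * A r with hI2
  have hsplit : ∫ r in (0:ℝ)..b, Real.exp (β / 4 * r ^ 2) * P r * q r = I1 - μ * I2 := by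
    rw [hI1, hI2, ← intervalIntegral.integral_const_mul, ← intervalIntegral.integral_sub]
    · refine intervalIntegral.integral_congr fun r _ => ?_
      simp only [hgdef]; ring
    · exact (((hEc _).mul hPc).mul hgc).intervalIntegrable _ _
    · exact (continuous_const.mul ((((hEc _).mul continuous_id).mul hPc).mul hAc)).intervalIntegrable _ _
  -- (3b) `|I2| ≤ √NP √NA`
  have hw_nonneg : ∀ r ∈ Icc (0:ℝ) b, 0 ≤ Real.exp (β / 4 * r ^ 2) * r := fun r hr => by
    have := hr.1; positivity
  have hwc : Continuous fun r => Real.exp (β / 4 * r ^ 2) * r := (hEc _).mul continuous_id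
  have hnorm : ∀ (G : ℝ → ℝ), ∫ r in (0:ℝ)..b, Real.exp (β / 4 * r ^ 2) * r * G r ^ 2 =
      ∫ r in (0:ℝ)..b, Real.exp (β / 4 * r ^ 2) * G r ^ 2 * r := fun G =>
    intervalIntegral.integral_congr fun r _ => by ring
  have hI2 : |I2| ≤ Real.sqrt NP * Real.sqrt NA := by
    have h := weighted_cs hb0 hw_nonneg hwc hPc hAc
    rw [hnorm P, hnorm A] at h
    rw [← Real.sqrt_mul hNP0]
    exact Real.abs_le_sqrt h
  -- (3c) `I1` on `[1,b]`
  have hPJ : ∫ r in (1:ℝ)..b, Real.exp (β / 4 * r ^ 2) * P r * g r ≤ Real.sqrt NP * (4 / β * Real.sqrt NF) := by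
    have step1 : ∫ r in (1:ℝ)..b, Real.exp (β / 4 * r ^ 2) * P r * g r ≤
        ∫ r in (1:ℝ)..b, Real.exp (β / 4 * r ^ 2) * r * |P r| * |J r| := by
      refine intervalIntegral.integral_mono_on hb1 ?_ ?_ fun r hr => ?_
      · exact (((hEc _).mul hPc).mul hgc).intervalIntegrable _ _
      · exact ((((hEc _).mul continuous_id).mul hPc.abs).mul hJc.abs).intervalIntegrable _ _
      · have hr1 : 1 ≤ r := hr.1
        have hr0 : 0 < r := by linarith
        have hgJ : g r = J r / r := by rw [← hrg r]; field_simp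
        have he : 0 ≤ Real.exp (β / 4 * r ^ 2) := (Real.exp_pos _).le
        calc Real.exp (β / 4 * r ^ 2) * P r * g r ≤ |Real.exp (β / 4 * r ^ 2) * P r * g r| := le_abs_self _
          _ = Real.exp (β / 4 * r ^ 2) * |P r| * |J r| / r := by
              rw [hgJ, abs_mul, abs_mul, abs_div, abs_of_nonneg he, abs_of_pos hr0]; ring
          _ ≤ Real.exp (β / 4 * r ^ 2) * |P r| * |J r| * r := by
              rw [div_le_iff₀ hr0]
              have h0 : 0 ≤ Real.exp (β / 4 * r ^ 2) * |P r| * |J r| := by positivity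
              have h1' : 0 ≤ r * r - 1 := by nlinarith
              nlinarith [mul_nonneg h0 h1']
          _ = Real.exp (β / 4 * r ^ 2) * r * |P r| * |J r| := by ring
    have step2 : ∫ r in (1:ℝ)..b, Real.exp (β / 4 * r ^ 2) * r * |P r| * |J r| ≤
        ∫ r in (0:ℝ)..b, Real.exp (β / 4 * r ^ 2) * r * |P r| * |J r| := by
      refine intervalIntegral.integral_mono_interval zero_le_one hb1 le_rfl ?_ ?_
      · refine MeasureTheory.ae_restrict_of_forall_mem measurableSet_Ioc fun r hr => ?_
        have := hr.1
        positivity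
      · exact ((((hEc _).mul continuous_id).mul hPc.abs).mul hJc.abs).intervalIntegrable _ _
    have step3 : (∫ r in (0:ℝ)..b, Real.exp (β / 4 * r ^ 2) * r * |P r| * |J r|) ^ 2 ≤
        NP * ∫ r in (0:ℝ)..b, Real.exp (β / 4 * r ^ 2) * J r ^ 2 * r := by
      have h := weighted_cs hb0 hw_nonneg hwc hPc.abs hJc.abs
      simp only [sq_abs] at h
      rw [hnorm P, hnorm J] at h
      exact h
    have hNJ : ∫ r in (0:ℝ)..b, Real.exp (β / 4 * r ^ 2) * J r ^ 2 * r ≤ (4 / β) ^ 2 * NF := by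
      have : (4 / β) ^ 2 = 16 / β ^ 2 := by ring
      rw [this]; exact hHardy
    have step4 : ∫ r in (0:ℝ)..b, Real.exp (β / 4 * r ^ 2) * r * |P r| * |J r| ≤
        Real.sqrt NP * (4 / β * Real.sqrt NF) := by
      have h1 : (∫ r in (0:ℝ)..b, Real.exp (β / 4 * r ^ 2) * r * |P r| * |J r|) ^ 2 ≤ NP * ((4 / β) ^ 2 * NF) :=
        step3.trans (mul_le_mul_of_nonneg_left hNJ hNP0)
      have h2 := Real.abs_le_sqrt h1
      rw [Real.sqrt_mul hNP0, Real.sqrt_mul (sq_nonneg _), Real.sqrt_sq (by positivity)] at h2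
      exact (le_abs_self _).trans h2
    exact step1.trans (step2.trans step4)
  -- (3d) `I1` on `[0,1]`
  set n : ℝ := Real.sqrt (NA / 2) with hn
  have hn0 : 0 ≤ n := Real.sqrt_nonneg _
  have hnsq : n ^ 2 = NA / 2 := Real.sq_sqrt (by positivity)
  have hA1 : ∫ s in (0:ℝ)..1, s * |A s| ≤ n := by
    have h := weighted_cs (b := 1) zero_le_one (w := fun s => s) (u := fun _ => (1:ℝ)) (v := fun s => |A s|)
      (fun s hs => hs.1) continuous_id continuous_const hAc.abs
    simp only [mul_one, one_pow, sq_abs] at h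
    have hid : ∫ s in (0:ℝ)..1, (s : ℝ) = 1 / 2 := by rw [integral_id]; norm_num
    rw [hid] at h
    have hA2 : ∫ s in (0:ℝ)..1, s * A s ^ 2 ≤ NA := by
      calc ∫ s in (0:ℝ)..1, s * A s ^ 2 ≤ ∫ s in (0:ℝ)..1, Real.exp (β / 4 * s ^ 2) * A s ^ 2 * s := by
            refine intervalIntegral.integral_mono_on zero_le_one ?_ ?_ fun s hs => ?_
            · exact (continuous_id.mul (hAc.pow 2)).intervalIntegrable _ _
            · exact (((hEc _).mul (hAc.pow 2)).mul continuous_id).intervalIntegrable _ _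
            · have hs0 := hs.1
              have he : 1 ≤ Real.exp (β / 4 * s ^ 2) := Real.one_le_exp (by positivity)
              have h0 : 0 ≤ s * A s ^ 2 := by positivity
              nlinarith
        _ ≤ NA := by
            rw [hNA]
            refine intervalIntegral.integral_mono_interval le_rfl zero_le_one hb1 ?_ ?_
            · refine MeasureTheory.ae_restrict_of_forall_mem measurableSet_Ioc fun r hr => ?_
              have := hr.1
              positivity
            · exact (((hEc _).mul (hAc.pow 2)).mul continuous_id).intervalIntegrable _ _
    have h3 : (∫ s in (0:ℝ)..1, s * |A s|) ^ 2 ≤ n ^ 2 := by rw [hnsq]; nlinarith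
    exact (abs_le_of_sq_le_sq' h3 hn0).2
  have hqb : ∀ s ∈ Ioc 0 b, |q s| ≤ m + |μ| * (s * |A s|) := by
    intro s hs
    have hs0 : 0 < s := hs.1
    have e : q s = g s - μ * (s * A s) := by simp only [hgdef]; ring
    rw [e]
    calc |g s - μ * (s * A s)| ≤ |g s| + |μ * (s * A s)| := abs_sub _ _
      _ ≤ m + |μ| * (s * |A s|) := by
          rw [abs_mul, abs_mul, abs_of_pos hs0]
          linarith [hgb s hs]
  have hintq : ∀ r ∈ Icc (0:ℝ) 1, ∫ s in (0:ℝ)..r, |q s| ≤ m + |μ| * n := by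
    intro r hr
    have hr0 : 0 ≤ r := hr.1
    have hr1 : r ≤ 1 := hr.2
    have st1 : ∫ s in (0:ℝ)..r, |q s| ≤ ∫ s in (0:ℝ)..r, (m + |μ| * (s * |A s|)) := by
      refine intervalIntegral.integral_mono_on_of_le_Ioo hr0 ?_ ?_ fun s hs => ?_
      · exact hqc.abs.intervalIntegrable _ _
      · exact (continuous_const.add (continuous_const.mul (continuous_id.mul hAc.abs))).intervalIntegrable _ _
      · exact hqb s ⟨hs.1, by linarith [hs.2]⟩
    have st2 : ∫ s in (0:ℝ)..r, (m + |μ| * (s * |A s|)) = m * r + |μ| * ∫ s in (0:ℝ)..r, s * |A s| := by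
      rw [intervalIntegral.integral_add, intervalIntegral.integral_const, intervalIntegral.integral_const_mul]
      · simp
        ring
      · exact continuous_const.intervalIntegrable _ _
      · exact (continuous_const.mul (continuous_id.mul hAc.abs)).intervalIntegrable _ _
    have st3 : ∫ s in (0:ℝ)..r, s * |A s| ≤ ∫ s in (0:ℝ)..1, s * |A s| := by
      refine intervalIntegral.integral_mono_interval le_rfl hr0 hr1 ?_ ?_
      · refine MeasureTheory.ae_restrict_of_forall_mem measurableSet_Ioc fun s hs => ?_
        have := hs.1
        positivity
      · exact (continuous_id.mul hAc.abs).intervalIntegrable _ _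
    have hmr : m * r ≤ m := by nlinarith
    have habs : 0 ≤ |μ| := abs_nonneg _
    calc ∫ s in (0:ℝ)..r, |q s| ≤ m * r + |μ| * ∫ s in (0:ℝ)..r, s * |A s| := st1.trans st2.le
      _ ≤ m + |μ| * n := by
          have := mul_le_mul_of_nonneg_left (st3.trans hA1) habs
          linarith
  have hPsup : ∀ r ∈ Icc (0:ℝ) 1, |P r| ≤ Real.exp (1 / 4) * (m + |μ| * n) := by
    intro r hr
    have h := volterra_center_abs_le hP hqc hq hP0 hr
    exact h.trans (mul_le_mul_of_nonneg_left (hintq r hr) (Real.exp_pos _).le)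
  set E : ℝ := Real.exp (1 / 4) * Real.exp (1 / 4) with hE
  have hE2 : E ≤ 2 := by
    have e1 : E = Real.exp (1 / 2) := by rw [hE, ← Real.exp_add]; norm_num
    have hsq : Real.exp (1 / 2) ^ 2 = Real.exp 1 := by
      rw [← Real.exp_nat_mul]; norm_num
    have h9 := Real.exp_one_lt_d9
    have hpos := Real.exp_pos (1 / 2 : ℝ)
    rw [e1]
    nlinarith
  have hE0 : 0 ≤ E := by positivity
  have hP01 : ∫ r in (0:ℝ)..1, Real.exp (β / 4 * r ^ 2) * P r * g r ≤ E * (m + |μ| * n) * m := by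
    have step : ∫ r in (0:ℝ)..1, Real.exp (β / 4 * r ^ 2) * P r * g r ≤
        ∫ r in (0:ℝ)..1, E * (m + |μ| * n) * m := by
      refine intervalIntegral.integral_mono_on_of_le_Ioo zero_le_one ?_ ?_ fun r hr => ?_
      · exact (((hEc _).mul hPc).mul hgc).intervalIntegrable _ _
      · exact continuous_const.intervalIntegrable _ _
      · have hr0 : 0 < r := hr.1
        have hr1 : r < 1 := hr.2
        have he' : Real.exp (β / 4 * r ^ 2) ≤ Real.exp (1 / 4) := by
          apply Real.exp_le_exp.2
          nlinarith [sq_nonneg r, mul_le_mul hβ1 (show r ^ 2 ≤ 1 by nlinarith) (sq_nonneg r) zero_le_one]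
        have hP' := hPsup r ⟨hr0.le, hr1.le⟩
        have hg' := hgb r ⟨hr0, by linarith⟩
        calc Real.exp (β / 4 * r ^ 2) * P r * g r ≤ |Real.exp (β / 4 * r ^ 2) * P r * g r| := le_abs_self _
          _ = Real.exp (β / 4 * r ^ 2) * |P r| * |g r| := by
              rw [abs_mul, abs_mul, abs_of_pos (Real.exp_pos _)]
          _ ≤ Real.exp (1 / 4) * (Real.exp (1 / 4) * (m + |μ| * n)) * m :=
              mul_le_mul (mul_le_mul he' hP' (abs_nonneg _) (Real.exp_pos _).le) hg' (abs_nonneg _)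
                (by positivity)
          _ = E * (m + |μ| * n) * m := by simp only [hE]; ring
    rw [intervalIntegral.integral_const] at step
    simpa using step
  -- (3e) assemble the bound on `∫ e P q`
  have hI1split : I1 = (∫ r in (0:ℝ)..1, Real.exp (β / 4 * r ^ 2) * P r * g r) +
      ∫ r in (1:ℝ)..b, Real.exp (β / 4 * r ^ 2) * P r * g r := by
    rw [hI1, intervalIntegral.integral_add_adjacent_intervals]
    · exact (((hEc _).mul hPc).mul hgc).intervalIntegrable _ _
    · exact (((hEc _).mul hPc).mul hgc).intervalIntegrable _ _
  set x := Real.sqrt NP with hx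
  set f := Real.sqrt NF with hf
  set a := Real.sqrt NA with ha
  have hx0 : 0 ≤ x := Real.sqrt_nonneg _
  have hf0 : 0 ≤ f := Real.sqrt_nonneg _
  have ha0 : 0 ≤ a := Real.sqrt_nonneg _
  have hxsq : x ^ 2 = NP := Real.sq_sqrt hNP0
  have hfsq : f ^ 2 = NF := Real.sq_sqrt hNF0
  have hasq : a ^ 2 = NA := Real.sq_sqrt hNA0
  have habsμ : 0 ≤ |μ| := abs_nonneg _
  have hmain : (2 - β) / 4 * NP ≤ E * (m + |μ| * n) * m + x * (4 / β * f) + |μ| * (x * a) := by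
    have h1 : ∫ r in (0:ℝ)..b, Real.exp (β / 4 * r ^ 2) * P r * q r ≤
        E * (m + |μ| * n) * m + x * (4 / β * f) + |μ| * (x * a) := by
      rw [hsplit, hI1split]
      have hμI : -(μ * I2) ≤ |μ| * (x * a) := by
        calc -(μ * I2) ≤ |μ * I2| := neg_le_abs _
          _ = |μ| * |I2| := abs_mul _ _
          _ ≤ |μ| * (x * a) := mul_le_mul_of_nonneg_left hI2 habsμ
      linarith [hP01, hPJ, hμI]
    exact henergy.trans h1
  -- (4) the scalar endgame
  exact s2b_algebra hβ hβ1 rfl hx0 hf0 ha0 hm0 hn0 hE0 hE2 hxsq hfsq hasq hmsq hnsq hmain hpin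


end Summit.NavierStokesRegularity.NavierStokesRegularity.Theorems
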